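import Summits.Ventures.Crystal3D.Theorems.StickyWulffConstantGenericWallFloorStarPairLocalSound
import Summits.Ventures.Crystal3D.Theorems.StickyWulffConstantGenericWallFloorDoubleTopLocalFrame
import HarnessLib

/-!
# Stars-only double stars, local part 3: the reference rotation of a star-supported certificate from the
# lattice vocabulary (crux `GenericWallFloor`, line `WallLedgerG`; input `StarPairCoaxial`)

HONEST FRAMING. Part of the venture `Summits/Ventures/Crystal3D` (cell `crystal3d-full`), helper
`--supports` the crux `GenericWallFloor` (stmt-Ventures-19480) of `route-Ventures-StickyWulffConstant`,
registered line `WallLedgerG`, open stub `stub_twoSlabAdhesion`.  The star version of wulff-p2's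
`DTCert.eq_of_isometry` (`…DoubleTopLocalFrame`): for a VALID, STAR-SUPPORTED certificate `C`, a linear isometry
`R` and a point `y` such that the STAR balls `wPt i`, `i ∈ starIdx` (the closed vertex star of `−slotSite 0` at the
top `0`) and their `R`-images are `1`-separated up to coincidence, `y` is a unit vector at distance `≥ 1` from the
ten star balls, and `(R, y)` lies in the certificate ball `‖cubicMat R · Bᵀ − 1‖_F² + 2‖y − y₀‖² < 1/Ktot`
(no `y`-term when `useY = false`): then `cubicMat R = B`, the certificate's co-axial reference rotation.
Proof = wulff-p2's, with `DTCert.sound_star` in place of `DTCert.sound`.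

WHAT THIS IS NOT: the co-axiality clause and the atlas (next files), the global half; rung F-C1 not moved.
-/

noncomputable section

namespace Summit.Ventures.Crystal3D.Theorems

open Matrix NearIdentity
open scoped InnerProductSpace

namespace NearIdentity.DTCert

variable (C : DTCert)

/-- **From the lattice vocabulary to a star-supported certificate.**  See the module docstring. -/
theorem eq_of_isometry_star (hC : C.valid) (hS5 : C.StarSupported)
    (R : EuclideanSpace ℝ (Fin 3) ≃ₗᵢ[ℝ] EuclideanSpace ℝ (Fin 3)) (y : EuclideanSpace ℝ (Fin 3))
    (hclus : ∀ i ∈ starIdx, ∀ j ∈ starIdx, wPt i = R (wPt j) ∨ 1 ≤ dist (wPt i) (R (wPt j)))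
    (hy : C.useY = true → ‖y‖ = 1)
    (hyF : C.useY = true → ∀ i ∈ starIdx, 1 ≤ dist y (wPt i))
    (hyM : C.useY = true → ∀ j ∈ starIdx, 1 ≤ dist y (R (wPt j)))
    (hsmall : frob (cubicMat R * C.bRᵀ - 1) + (if C.useY then 2 * ‖y - C.y0E‖ ^ 2 else 0) < 1 / C.Ktot) :
    cubicMat R = C.bR := by
  have hB : C.validB := hC.2.2.2.2.2.2.2
  obtain ⟨hBtB, hBBt⟩ := C.bR_orth hB
  set M := cubicMat R with hM
  set κ : Matrix (Fin 3) (Fin 3) ℝ := M * C.bRᵀ - 1 with hκ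
  have h1κ : 1 + κ = M * C.bRᵀ := by rw [hκ]; abel
  have hMtM : Mᵀ * M = 1 := cubicMat_orth R
  have hprod : (1 + κ)ᵀ * (1 + κ) = 1 := by
    rw [h1κ, Matrix.transpose_mul, Matrix.transpose_transpose, Matrix.mul_assoc, ← Matrix.mul_assoc Mᵀ,
      hMtM, Matrix.one_mul, hBBt]
  have horth : ∀ i j, κ i j + κ j i + ∑ l, κ l i * κ l j = 0 := by
    intro i j
    have h := congrFun (congrFun hprod i) j
    rw [Matrix.mul_apply, Matrix.one_apply] at h
    simp only [Matrix.transpose_apply, Matrix.add_apply, Matrix.one_apply] at h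
    simp only [Fin.sum_univ_three] at h ⊢
    fin_cases i <;> fin_cases j <;> simp at h ⊢ <;> linarith
  have hmov : ∀ j, C.qR j + κ *ᵥ C.qR j = Real.sqrt 2 • cubicCoords (R (wPt j)) := by
    intro j
    have e1 : C.qR j + κ *ᵥ C.qR j = (1 + κ) *ᵥ C.qR j := by rw [Matrix.add_mulVec, Matrix.one_mulVec]
    rw [e1, h1κ, C.qR_eq_bR_mulVec hB j, Matrix.mulVec_mulVec, Matrix.mul_assoc, hBtB, Matrix.mul_one,
      cubicCoords_eq_cubicMat_mulVec, ← sqrt_two_smul_cubicCoords_wPt, Matrix.mulVec_smul]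
  set yh : Fin 3 → ℝ := Real.sqrt 2 • cubicCoords y with hyh
  have Hclus : ∀ i ∈ starIdx, ∀ j ∈ starIdx, fR i = C.qR j + κ *ᵥ C.qR j ∨
      2 ≤ (fR i - (C.qR j + κ *ᵥ C.qR j)) ⬝ᵥ (fR i - (C.qR j + κ *ᵥ C.qR j)) := by
    intro i hi j hj
    rw [hmov j, ← sqrt_two_smul_cubicCoords_wPt i]
    rcases hclus i hi j hj with h | h
    · left; rw [h]
    · right
      rw [← smul_sub, ← cubicCoords_sub, sqrt_two_smul_cubicCoords_dot_self, ← dist_eq_norm]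
      nlinarith [h]
  have Hy : C.useY = true → yh ⬝ᵥ yh = 2 := by
    intro huse; rw [hyh, sqrt_two_smul_cubicCoords_dot_self, hy huse]; norm_num
  have HcF : C.useY = true → ∀ i ∈ starIdx, 2 ≤ (yh - fR i) ⬝ᵥ (yh - fR i) := by
    intro huse i hi
    rw [hyh, ← sqrt_two_smul_cubicCoords_wPt i, ← smul_sub, ← cubicCoords_sub, sqrt_two_smul_cubicCoords_dot_self,
      ← dist_eq_norm]
    nlinarith [hyF huse i hi]
  have HcM : C.useY = true → ∀ j ∈ starIdx,
      2 ≤ (yh - (C.qR j + κ *ᵥ C.qR j)) ⬝ᵥ (yh - (C.qR j + κ *ᵥ C.qR j)) := by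
    intro huse j hj
    rw [hyh, hmov j, ← smul_sub, ← cubicCoords_sub, sqrt_two_smul_cubicCoords_dot_self, ← dist_eq_norm]
    nlinarith [hyM huse j hj]
  have Hsmall : frob κ + (if C.useY then (yh - C.y0R) ⬝ᵥ (yh - C.y0R) else 0) < 1 / C.Ktot := by
    have e : (yh - C.y0R) ⬝ᵥ (yh - C.y0R) = 2 * ‖y - C.y0E‖ ^ 2 := by
      rw [hyh, ← C.sqrt_two_smul_cubicCoords_y0E, ← smul_sub, ← cubicCoords_sub,
        sqrt_two_smul_cubicCoords_dot_self]
    rw [e]; exact hsmall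
  have hκ0 : κ = 0 := C.sound_star hC hS5 κ horth yh Hclus Hy HcF HcM Hsmall
  have h1 : M * C.bRᵀ = 1 := by rw [← h1κ, hκ0, add_zero]
  calc M = M * (C.bRᵀ * C.bR) := by rw [hBtB, Matrix.mul_one]
    _ = (M * C.bRᵀ) * C.bR := by rw [Matrix.mul_assoc]
    _ = C.bR := by rw [h1, Matrix.one_mul]

end NearIdentity.DTCert

end Summit.Ventures.Crystal3D.Theorems

end
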